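import Literature.MathematicalPhysics.QuantumFieldTheory.Balaban1983to89.B10Eq29TubeLine
import Summits.QuantumFields.YangMills.Theorems.BalabanUVNodesN19LipBracketTube

/-!
# BalabanUVNodes ∕ N19 — the pair discs of the tube reading of (T) FROM THE TREE'S OWN [B10] TUBE VOCABULARY:
# (2.27)(ii)(iv) read AS PRINTED — «`E(X; g, ·)` holomorphic on a space containing the (I.1.13) tubes about the run-A
# backgrounds, (I.1.18)-bounded there» — in the letters of `B10Eq29TubeLine` (`Tube`, `TubeCfg`, the exponential line)
# (cell `pub-ymgap`, HUMAN RULING D-0062 Track A, node N19 = NE7, R134 seat dag-n19-c g3, strategy s1″; count-neutral)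

HONEST FRAMING.  One fixed finite four-torus, rung (B)+1 (existence AND uniqueness of the `ε → 0` limit of Bałaban's
unit-scale averaged loop expectations) — NOT infinite volume, NOT OS on ℝ⁴, NOT a mass gap, NOT the Clay problem.  NE7
(`Spine.NE7.Core` ∕ `T4MatchingAssembly.HybridNE7`) is NOT PRINTED and NOT proved here; N19 is NOT discharged.  THEOREMS
ONLY; 0 `def`; 0 `sorry`; standard axioms.  Nothing of Bałaban's is instantiated: the bond set `ι`, the C⋆-algebra `𝔸`,
the chart `emb`, the extension `Ecx`, the spaces `sp`, the carriers and the letters are PARAMETERS (NODE O ∕ the record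
predicate instantiates them on the carriers of `Node00.Record12`).  Filed `--supports` the K3′ item `SpineGivenEndpointR12`
AS A HELPER; NOT a discharge claim; an implication between hypothesis sets plus bookkeeping.

WHICH HYPOTHESIS.  After this seat's g2 (`BalabanUVNodesN19LipBracketTube`, `…TubeWitness`, `…RateEdgeTube`,
`…TubeLiaison`) the bracket (T) = `LipBackground R.u3.EA R.u3.W R.u3.κ CU ∧ PolyLipGrowth CU g Pg 1 ∧ 0 ≤ Pg` of
`T4OutputRate.u3_threeBrackets` is consumed at both N19 edge readings from ELEVEN binders, of which exactly ONE has a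
shape that is ours and not print's: the PAIR-DISC EXISTENTIAL
`hdisc : ∀ g ∈ W, ∀ X U U′, gauge U U′ < ϱ_{g,j} → ∃ f : ℂ → ℂ, DifferentiableOn ℂ f (ball 0 ϱ_{g,j}) ∧ f 0 = E(X;g,U) ∧
f (gauge U U′) = E(X;g,U′) ∧ ‖f‖ ≤ E₀e^{−κd(X)} on the disc` (`N19LipBracketTube.lipBackground_of_pairDisc`).  Print says
instead ([Balaban1988Convergent] (2.27) p. 259): *(ii)* `E^{(j)}(X; g, ·)` extends to an ANALYTIC function on the space
`Ũᶜ_j(X, α_{0,j}, α_{1,j})`; *(iv)* the extension obeys (I.1.18) `|E^{(j)}(X; …)| ≤ E₀ exp(−κd_j(X))` there; and the space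
is ([Balaban1987RG1] (1.13) p. 262) the set of configurations `𝐔 = U′U` with `U` a (regular, real) background and
`U′ = exp iξA′`, `A′ ∈ gᶜ`, `|A′|, |∇^ξ_U A′| < α₁` — at one bond EXACTLY the tree's `B10Eq29TubeLine.Tube 𝔸 α =
{exp(B)·U : ‖B‖ < α, U unitary}` (b2b paper-cell lineage b10, the model objects of [Balaban1985UV3] (29) through a complex
background; `TubeCfg ι 𝔸 α` bondwise).  THIS MODULE DERIVES `hdisc` FROM THAT PRINTED SHAPE, typed over the abstract
carriers with: a finite bond set `ι`; a C⋆-algebra `𝔸` (intended `SU(2) ⊂ M₂(ℂ)`); a chart `emb : BgA → ι → 𝔸` of the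
run-A backgrounds; for every admissible `g` and domain `X` a space `sp g X ⊆ (ι → 𝔸)` and an extension
`Ecx g X : (ι → 𝔸) → ℂ` of `E(X; g, ·)` (`Ecx g X (emb U) = EA g U X`) that is HOLOMORPHIC on `sp g X` ((2.27)(ii):
`DifferentiableOn ℂ`) and (1.18)-BOUNDED there ((2.27)(iv)); the (1.13) TUBE of half-width `ϱ_{g,j}` about every run-A
background INSIDE the space (`sz U K < ϱ ⇒ (b ↦ exp(K b)·emb U b) ∈ sp g X` for a background-dependent SIZE functional
`sz`, absolutely homogeneous — the sup norm `|A′|`, or the C¹ size `max(|A′|, |∇_U A′|)` of (1.13), located item (a) of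
the g2 header); and the chart convention of `T4OutputRate` §1 that the carrier's gauge IS the size of the connecting
generator (`gauge U U′ < ϱ ⇒ ∃ K, sz U K ≤ gauge U U′ ∧ emb U′ = exp(K)·emb U`).  THE DEVICE: the PAIR LINE
`z ↦ (b ↦ exp((z∕δ)•K b)·emb U b)`, `δ = gauge U U′`, is ENTIRE (`B10Eq29TubeLine.differentiable_exp_smul_mul` bondwise,
`differentiable_pi`), sits at `emb U` for `z = 0` and at `emb U′` for `z = δ`, and for `|z| < ϱ` its generator `(z∕δ)•K`
has size `≤ |z|∕δ·δ < ϱ`, so it runs inside the tube, inside the space: `f = Ecx g X ∘ line` is the pair disc.  A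
DEGENERATE pair (`δ = 0`, so `sz U K ≤ 0`) is joined by the WHOLE entire line `z ↦ exp(z•K)·emb U` inside the space, on
which `Ecx g X` is bounded — by LIOUVILLE (`Differentiable.apply_eq_apply_of_bounded`) `E(X;g,U) = E(X;g,U′)` and the
constant disc serves; no definiteness of `sz` is assumed.

WHAT THIS FILE PROVES (every Bałaban clause a HYPOTHESIS SHAPE over the abstract carriers, never a fact):
* §1 `differentiable_expPair` (the pair line is entire), `norm_div_mul_le` (arithmetic of the scaling),
  ★ `pairDisc_of_tubeLine` (MAIN, size-generic: the six tube binders ⇒ `hdisc` VERBATIM at the same radius family),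
  `pairDisc_of_tubeLine_norm` (the instance `sz U K = ‖K‖ = sup_b ‖K b‖`, bondwise letters — b10's `Tube` currency),
  `pairDisc_of_tubeCfg` (b10's exact (L1′) letters: `TubeCfg ι 𝔸 ϱ_{g,j} ⊆ sp g X` with `emb` bondwise unitary),
  `decayBound_of_tubeLine` (the real bound (1.18) `DecayBound EA W E₀ κ` is CONTAINED: generator `0`).
* §2 `lipBackground_of_tubeLine` (∘ `N19LipBracketTube.lipBackground_of_pairDisc`: `LipBackground EA W κ (2E₀∕ϱ)`),
  `lipBracket_of_tubeLine` (∘ `lipBracket_of_pairDisc` at the printed radius `κ₁·α(C₁, q₁, g_j)` (2.28)·(2.39)),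
  **`lipBracket_at_u3Carriers_of_tubeLine`** ∕ `lipBracket_at_rateCarriers_of_tubeLine` — LITERALLY the component (T)
  of `N19RateEdgeByName.rateEdge_of_linkReading_byName` (`q := 1`) at `YMDAG.UVSplit.U3Carriers` ∕ `RateCarriers.u3` from:
  the chart `emb`, the size `sz`, the spaces `sp`, the extension `Ecx` with (2.27)(ii)(iv) and real agreement, the reach
  convention, and g2's LETTERS (`0 ≤ E₀`, `0 < κ₁`, `0 < C₁`, window smallness, tables `g K ∈ u.W` with the upper running
  (2.6)∕(0.31)) — `hdecay` of g2's list is now DERIVED, `hdisc` REPLACED by print's shape in tree letters.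

WHAT REMAINS HYPOTHESIS (census of (T) after this module; owner NODE O unless said): the objects `ι`, `𝔸`, `emb`, `sp`,
`Ecx` on the carriers of record and the three printed clauses about them — (2.27)(ii) holomorphy on `sp g X`, (2.27)(iv)
the (1.18) bound on `sp g X`, (1.13)∕(2.39) «the tube of half-width `κ₁α_{1,j}` about a run-A background lies in
`Ũᶜ_j(X)`» (by DEFINITION of the space once `sz` is the chart's `A′`-size and the run-A carrier is the regular real
space (1.12) — `T4OutputRate` §1: «background carriers … ALREADY RESTRICTED to the synchronised small-field ∕ analyticity
domains»); the reach convention (gauge = generator size; `T4OutputRate` §1: «closeness gauge on `BgA` (the sup-quantities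
of the spaces U^c_j(X, α₀, α₁))»); the J-coordinate of (I.1.9) (both arguments move — N16's rates; not modelled, as in
g2); the LETTERS and the (2.6)∕(0.31) upper running (β-side, displayed).  NOT claimed: that Bałaban's `E^{(j)}` satisfies
any of it (one-run, printed, NODE O reads it off); the converse pair-disc ⇒ tube.

CITATION HEADER (LOCATIONS only, as transcribed in the headers of the imported modules `B10Eq29TubeLine` §0,
`T4OutputRate`, `N19LipBracketTube`; no decl below carries a cite tag).  [Balaban1987RG1] T. Bałaban, CMP **109** (1987)
249–301 — (1.11)–(1.13) p. 262, (1.17)–(1.18) p. 263.  [Balaban1988Convergent] T. Bałaban, CMP **119** (1988) 243–285 —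
(2.27)(ii)(iv), (2.28) p. 259, (2.39) p. 261.  [Balaban1985BackgroundPropagators] CMP **99** (1985) (3.37) p. 396 (the
tube).  [Balaban1985UV3] CMP **102** (1985) (29) p. 263 (the exponential line).  Mathlib: `Differentiable.apply_eq_apply_of_bounded`
(Liouville), `hasDerivAt_exp_smul_const` (via `B10Eq29TubeLine.differentiable_exp_smul_mul`), `differentiable_pi`.
-/

open Metric Set NormedSpace Bornology

namespace Summit.QuantumFields.YangMills.BalabanUVNodes.N19LipBracketTubeLine

open Literature.MathematicalPhysics.QuantumFieldTheory.Balaban1983to89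
open T4OutputRate (Carriers Functional DecayBound LipBackground)
open T4TowerRateComposition (PolyLipGrowth)
open B10Eq29TubeLine (Tube TubeCfg exp_mul_mem_tube differentiable_exp_smul_mul)
open N19LipBracketTube (lipBackground_of_pairDisc lipBracket_of_pairDisc radius_pos)

/-! ## §1 The pair line in the [B10] tube model and the pair discs -/

section PairLine

variable {ι : Type*} [Fintype ι] {𝔸 : Type*} [CStarAlgebra 𝔸]

omit [Fintype ι] in
/-- **THE PAIR LINE IS ENTIRE.**  For a generator `K : ι → 𝔸`, a base configuration `V` and a real scale `δ`, the line
`z ↦ (b ↦ exp((z∕δ)•K b)·V b)` is complex-differentiable on `ℂ` (bondwise `B10Eq29TubeLine.differentiable_exp_smul_mul`,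
i.e. Mathlib's `hasDerivAt_exp_smul_const`, composed with `z ↦ z∕δ`; `differentiable_pi` over the finite bond set).
[folklore] -/
theorem differentiable_expPair (K V : ι → 𝔸) (δ : ℝ) :
    Differentiable ℂ (fun z : ℂ => fun b => exp ((z / δ) • K b) * V b) :=
  differentiable_pi.mpr fun b =>
    (differentiable_exp_smul_mul (K b) (V b)).comp (differentiable_id.div_const (δ : ℂ))

/-- Arithmetic of the scaling: `‖z∕δ‖·δ ≤ ‖z‖` for `0 ≤ δ` (equality for `δ > 0`, and `0 ≤ ‖z‖` for `δ = 0`, where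
`z∕0 = 0`). [folklore] -/
theorem norm_div_mul_le (z : ℂ) {δ : ℝ} (hδ : 0 ≤ δ) : ‖z / (δ : ℂ)‖ * δ ≤ ‖z‖ := by
  rcases hδ.eq_or_lt with h0 | hpos
  · rw [← h0, mul_zero]; exact norm_nonneg z
  · rw [norm_div, Complex.norm_real, Real.norm_eq_abs, abs_of_pos hpos, div_mul_cancel₀ _ hpos.ne']

variable {C : Carriers}

/-- ★ **PAIR DISCS FROM THE TUBE, SIZE-GENERIC** (the (1.13)∕(2.39) tube read through the tree's [B10] exponential line).
DATA over the abstract carriers (ALL HYPOTHESIS SHAPES; NODE O instantiates): a chart `emb` of run-A backgrounds into bond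
configurations `ι → 𝔸`; a background-dependent SIZE `sz U K` of generators, absolutely homogeneous
(`sz U (c•K) ≤ ‖c‖·sz U K` — the sup norm `|A′|` or the C¹ size `max(|A′|, |∇_U A′|)` of (1.13)); spaces `sp g X`
containing the TUBE of half-width `ϱ g j` about every run-A background (`sz U K < ϱ ⇒ exp(K)·emb U ∈ sp g X`, (1.13) by
definition of `Ũᶜ_j(X)`); an extension `Ecx g X` of `E(X; g, ·)` HOLOMORPHIC on `sp g X` ((2.27)(ii)) with the (1.18) bound
there ((2.27)(iv)) and real agreement `Ecx g X (emb U) = EA g U X`; and the chart convention «gauge = size of the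
connecting generator» (`gauge U U′ < ϱ ⇒ ∃ K, sz U K ≤ gauge U U′ ∧ emb U′ = exp(K)·emb U`).  CONCLUSION: the pair-disc
shape `hdisc` of `N19LipBracketTube.lipBackground_of_pairDisc` VERBATIM — `f = Ecx g X ∘ (z ↦ exp((z∕δ)•K)·emb U)`,
`δ = gauge U U′ > 0`; a degenerate pair `δ = 0` by Liouville along the entire bounded line `z ↦ Ecx g X (exp(z•K)·emb U)`.
[folklore] -/
theorem pairDisc_of_tubeLine {EA : Functional C C.BgA} {W : Set (ℕ → ℝ)} {κ E₀ : ℝ} {ϱ : (ℕ → ℝ) → ℕ → ℝ}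
    (emb : C.BgA → ι → 𝔸) (sz : C.BgA → (ι → 𝔸) → ℝ) (sp : (ℕ → ℝ) → C.Dom → Set (ι → 𝔸))
    (Ecx : (ℕ → ℝ) → C.Dom → (ι → 𝔸) → ℂ)
    -- the size functional is absolutely homogeneous
    (hsz : ∀ (U : C.BgA) (K : ι → 𝔸) (c : ℂ), sz U (c • K) ≤ ‖c‖ * sz U K)
    -- (1.13)∕(2.39): the tube of half-width ϱ_{g,j} about every run-A background lies in the space
    (htube : ∀ g ∈ W, ∀ (X : C.Dom) (U : C.BgA) (K : ι → 𝔸), sz U K < ϱ g (C.scale X) →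
      (fun b => exp (K b) * emb U b) ∈ sp g X)
    -- (2.27)(ii): the extension is holomorphic on the space
    (hhol : ∀ g ∈ W, ∀ X : C.Dom, DifferentiableOn ℂ (Ecx g X) (sp g X))
    -- (2.27)(iv): the (1.18) bound on the space
    (hbd : ∀ g ∈ W, ∀ (X : C.Dom), ∀ V ∈ sp g X, ‖Ecx g X V‖ ≤ E₀ * Real.exp (-(κ * C.d X)))
    -- the extension agrees with run A's functional on the real backgrounds
    (hreal : ∀ g ∈ W, ∀ (X : C.Dom) (U : C.BgA), Ecx g X (emb U) = (EA g U X : ℂ))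
    -- chart convention: the gauge is the size of the connecting generator
    (hreach : ∀ g ∈ W, ∀ (X : C.Dom) (U U' : C.BgA), C.gauge U U' < ϱ g (C.scale X) →
      ∃ K : ι → 𝔸, sz U K ≤ C.gauge U U' ∧ emb U' = fun b => exp (K b) * emb U b) :
    ∀ g ∈ W, ∀ (X : C.Dom) (U U' : C.BgA), C.gauge U U' < ϱ g (C.scale X) →
      ∃ f : ℂ → ℂ, DifferentiableOn ℂ f (ball (0 : ℂ) (ϱ g (C.scale X))) ∧ f 0 = (EA g U X : ℂ) ∧
        f (C.gauge U U' : ℂ) = (EA g U' X : ℂ) ∧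
        ∀ z ∈ ball (0 : ℂ) (ϱ g (C.scale X)), ‖f z‖ ≤ E₀ * Real.exp (-(κ * C.d X)) := by
  intro g hg X U U' hgap
  set δ := C.gauge U U' with hδdef
  set ρ := ϱ g (C.scale X) with hρdef
  set M := E₀ * Real.exp (-(κ * C.d X)) with hMdef
  have hδ0 : 0 ≤ δ := C.gauge_nonneg U U'
  obtain ⟨K, hKδ, hU'⟩ := hreach g hg X U U' hgap
  -- every scaled generator `c • K` with `‖c‖·δ < ρ` keeps the line point inside the space
  have hmem : ∀ c : ℂ, ‖c‖ * δ < ρ → (fun b => exp (c • K b) * emb U b) ∈ sp g X := by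
    intro c hc
    refine htube g hg X U (c • K) ?_
    calc sz U (c • K) ≤ ‖c‖ * sz U K := hsz U K c
      _ ≤ ‖c‖ * δ := mul_le_mul_of_nonneg_left hKδ (norm_nonneg c)
      _ < ρ := hc
  rcases hδ0.eq_or_lt with hδz | hδpos
  · -- DEGENERATE PAIR `δ = 0`: the whole entire line `z ↦ exp(z•K)·emb U` lies in the space; Liouville
    have hρ : 0 < ρ := hδ0.trans_lt hgap
    have hline : ∀ z : ℂ, (fun b => exp (z • K b) * emb U b) ∈ sp g X :=
      fun z => hmem z (by rw [← hδz, mul_zero]; exact hρ)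
    have hFd : Differentiable ℂ (fun z : ℂ => Ecx g X (fun b => exp (z • K b) * emb U b)) := by
      have hl : Differentiable ℂ (fun z : ℂ => fun b => exp (z • K b) * emb U b) :=
        differentiable_pi.mpr fun b => differentiable_exp_smul_mul (K b) (emb U b)
      have h : DifferentiableOn ℂ ((Ecx g X) ∘ fun z : ℂ => fun b => exp (z • K b) * emb U b) univ :=
        (hhol g hg X).comp hl.differentiableOn fun z _ => hline z
      exact differentiableOn_univ.mp h
    have hFb : ∀ z : ℂ, ‖Ecx g X (fun b => exp (z • K b) * emb U b)‖ ≤ M := fun z => hbd g hg X _ (hline z)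
    have hF01 : Ecx g X (fun b => exp ((0 : ℂ) • K b) * emb U b) =
        Ecx g X (fun b => exp ((1 : ℂ) • K b) * emb U b) :=
      hFd.apply_eq_apply_of_bounded
        ((isBounded_closedBall (x := (0 : ℂ)) (r := M)).subset
          (range_subset_iff.2 fun z => mem_closedBall_zero_iff.2 (hFb z))) 0 1
    have hF0 : Ecx g X (fun b => exp ((0 : ℂ) • K b) * emb U b) = (EA g U X : ℂ) := by
      have e : (fun b => exp ((0 : ℂ) • K b) * emb U b) = emb U := by
        funext b; rw [zero_smul, exp_zero, one_mul]
      rw [e, hreal g hg X U]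
    have hF1 : Ecx g X (fun b => exp ((1 : ℂ) • K b) * emb U b) = (EA g U' X : ℂ) := by
      have e : (fun b => exp ((1 : ℂ) • K b) * emb U b) = emb U' := by
        rw [hU']; funext b; rw [one_smul]
      rw [e, hreal g hg X U']
    refine ⟨fun _ => (EA g U X : ℂ), differentiableOn_const _, rfl, ?_, ?_⟩
    · show (EA g U X : ℂ) = (EA g U' X : ℂ)
      rw [← hF0, hF01, hF1]
    · intro z _
      show ‖(EA g U X : ℂ)‖ ≤ M
      rw [← hF0]
      exact hFb 0
  · -- GENERIC PAIR `δ > 0`: the pair line `z ↦ exp((z∕δ)•K)·emb U`, `|z| < ρ`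
    have hin : ∀ z ∈ ball (0 : ℂ) ρ, (fun b => exp ((z / δ) • K b) * emb U b) ∈ sp g X := by
      intro z hz
      rw [mem_ball_zero_iff] at hz
      exact hmem (z / δ) ((norm_div_mul_le z hδ0).trans_lt hz)
    refine ⟨fun z => Ecx g X (fun b => exp ((z / δ) • K b) * emb U b), ?_, ?_, ?_, ?_⟩
    · exact (hhol g hg X).comp (differentiable_expPair K (emb U) δ).differentiableOn hin
    · show Ecx g X (fun b => exp (((0 : ℂ) / δ) • K b) * emb U b) = (EA g U X : ℂ)
      have e : (fun b => exp (((0 : ℂ) / δ) • K b) * emb U b) = emb U := by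
        funext b; rw [zero_div, zero_smul, exp_zero, one_mul]
      rw [e, hreal g hg X U]
    · show Ecx g X (fun b => exp (((δ : ℂ) / δ) • K b) * emb U b) = (EA g U' X : ℂ)
      have hne : (δ : ℂ) ≠ 0 := Complex.ofReal_ne_zero.mpr hδpos.ne'
      have e : (fun b => exp (((δ : ℂ) / δ) • K b) * emb U b) = emb U' := by
        rw [hU']; funext b; rw [div_self hne, one_smul]
      rw [e, hreal g hg X U']
    · intro z hz
      exact hbd g hg X _ (hin z hz)

/-- **THE SAME IN THE SUP-NORM CURRENCY OF `B10Eq29TubeLine.Tube`** (`|A′| < α₁` bond by bond): size `‖K‖ = sup_b ‖K b‖`,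
tube binder and reach convention stated BONDWISE (`∀ b, ‖K b‖ < ϱ ⇒ exp(K)·emb U ∈ sp g X`;
`gauge U U′ < ϱ ⇒ ∃ K, (∀ b, ‖K b‖ ≤ gauge U U′) ∧ emb U′ = exp(K)·emb U`). [folklore] -/
theorem pairDisc_of_tubeLine_norm {EA : Functional C C.BgA} {W : Set (ℕ → ℝ)} {κ E₀ : ℝ}
    {ϱ : (ℕ → ℝ) → ℕ → ℝ} (emb : C.BgA → ι → 𝔸) (sp : (ℕ → ℝ) → C.Dom → Set (ι → 𝔸))
    (Ecx : (ℕ → ℝ) → C.Dom → (ι → 𝔸) → ℂ)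
    (htube : ∀ g ∈ W, ∀ (X : C.Dom) (U : C.BgA) (K : ι → 𝔸), (∀ b, ‖K b‖ < ϱ g (C.scale X)) →
      (fun b => exp (K b) * emb U b) ∈ sp g X)
    (hhol : ∀ g ∈ W, ∀ X : C.Dom, DifferentiableOn ℂ (Ecx g X) (sp g X))
    (hbd : ∀ g ∈ W, ∀ (X : C.Dom), ∀ V ∈ sp g X, ‖Ecx g X V‖ ≤ E₀ * Real.exp (-(κ * C.d X)))
    (hreal : ∀ g ∈ W, ∀ (X : C.Dom) (U : C.BgA), Ecx g X (emb U) = (EA g U X : ℂ))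
    (hreach : ∀ g ∈ W, ∀ (X : C.Dom) (U U' : C.BgA), C.gauge U U' < ϱ g (C.scale X) →
      ∃ K : ι → 𝔸, (∀ b, ‖K b‖ ≤ C.gauge U U') ∧ emb U' = fun b => exp (K b) * emb U b) :
    ∀ g ∈ W, ∀ (X : C.Dom) (U U' : C.BgA), C.gauge U U' < ϱ g (C.scale X) →
      ∃ f : ℂ → ℂ, DifferentiableOn ℂ f (ball (0 : ℂ) (ϱ g (C.scale X))) ∧ f 0 = (EA g U X : ℂ) ∧
        f (C.gauge U U' : ℂ) = (EA g U' X : ℂ) ∧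
        ∀ z ∈ ball (0 : ℂ) (ϱ g (C.scale X)), ‖f z‖ ≤ E₀ * Real.exp (-(κ * C.d X)) :=
  pairDisc_of_tubeLine emb (fun _ K => ‖K‖) sp Ecx (fun _ K c => (norm_smul c K).le)
    (fun g hg X U K hK => htube g hg X U K fun b => (norm_le_pi_norm K b).trans_lt hK) hhol hbd hreal
    (fun g hg X U U' h => by
      obtain ⟨K, hK, hU'⟩ := hreach g hg X U U' h
      exact ⟨K, (pi_norm_le_iff_of_nonneg (C.gauge_nonneg U U')).2 hK, hU'⟩)

/-- **THE SAME IN `B10Eq29TubeLine`'s EXACT (L1′) LETTERS**: the chart is bondwise UNITARY (real backgrounds have values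
in `G`) and the space contains the whole bondwise tube `TubeCfg ι 𝔸 ϱ_{g,j}` ([Balaban1988RG2Cluster] p. 15 as typed in
`B10Eq29TubeLine.lineInStrip_expLine`: «the analyticity space CONTAINS the bondwise tube»); membership of the line points
by `B10Eq29TubeLine.exp_mul_mem_tube`. [folklore] -/
theorem pairDisc_of_tubeCfg {EA : Functional C C.BgA} {W : Set (ℕ → ℝ)} {κ E₀ : ℝ} {ϱ : (ℕ → ℝ) → ℕ → ℝ}
    (emb : C.BgA → ι → 𝔸) (sp : (ℕ → ℝ) → C.Dom → Set (ι → 𝔸)) (Ecx : (ℕ → ℝ) → C.Dom → (ι → 𝔸) → ℂ)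
    (hemb : ∀ (U : C.BgA) (b : ι), emb U b ∈ unitary 𝔸)
    (hsp : ∀ g ∈ W, ∀ X : C.Dom, TubeCfg ι 𝔸 (ϱ g (C.scale X)) ⊆ sp g X)
    (hhol : ∀ g ∈ W, ∀ X : C.Dom, DifferentiableOn ℂ (Ecx g X) (sp g X))
    (hbd : ∀ g ∈ W, ∀ (X : C.Dom), ∀ V ∈ sp g X, ‖Ecx g X V‖ ≤ E₀ * Real.exp (-(κ * C.d X)))
    (hreal : ∀ g ∈ W, ∀ (X : C.Dom) (U : C.BgA), Ecx g X (emb U) = (EA g U X : ℂ))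
    (hreach : ∀ g ∈ W, ∀ (X : C.Dom) (U U' : C.BgA), C.gauge U U' < ϱ g (C.scale X) →
      ∃ K : ι → 𝔸, (∀ b, ‖K b‖ ≤ C.gauge U U') ∧ emb U' = fun b => exp (K b) * emb U b) :
    ∀ g ∈ W, ∀ (X : C.Dom) (U U' : C.BgA), C.gauge U U' < ϱ g (C.scale X) →
      ∃ f : ℂ → ℂ, DifferentiableOn ℂ f (ball (0 : ℂ) (ϱ g (C.scale X))) ∧ f 0 = (EA g U X : ℂ) ∧
        f (C.gauge U U' : ℂ) = (EA g U' X : ℂ) ∧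
        ∀ z ∈ ball (0 : ℂ) (ϱ g (C.scale X)), ‖f z‖ ≤ E₀ * Real.exp (-(κ * C.d X)) :=
  pairDisc_of_tubeLine_norm emb sp Ecx
    (fun g hg X U _K hK => hsp g hg X fun b => exp_mul_mem_tube (hK b) (hemb U b)) hhol hbd hreal hreach

omit [Fintype ι] in
/-- **THE REAL BOUND (1.18) IS CONTAINED** (bookkeeping, size-generic letters): with positive radii, every run-A
background `emb U = exp(0)·emb U` lies in its own tube (`sz U 0 ≤ ‖0‖·sz U 0 = 0 < ϱ`), so the (1.18) bound of the
extension on the space and real agreement give `DecayBound EA W E₀ κ` — g2's binder `hdecay` is DERIVED in this reading.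
[folklore] -/
theorem decayBound_of_tubeLine {EA : Functional C C.BgA} {W : Set (ℕ → ℝ)} {κ E₀ : ℝ} {ϱ : (ℕ → ℝ) → ℕ → ℝ}
    (emb : C.BgA → ι → 𝔸) (sz : C.BgA → (ι → 𝔸) → ℝ) (sp : (ℕ → ℝ) → C.Dom → Set (ι → 𝔸))
    (Ecx : (ℕ → ℝ) → C.Dom → (ι → 𝔸) → ℂ) (hϱ : ∀ g ∈ W, ∀ j, 0 < ϱ g j)
    (hsz : ∀ (U : C.BgA) (K : ι → 𝔸) (c : ℂ), sz U (c • K) ≤ ‖c‖ * sz U K)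
    (htube : ∀ g ∈ W, ∀ (X : C.Dom) (U : C.BgA) (K : ι → 𝔸), sz U K < ϱ g (C.scale X) →
      (fun b => exp (K b) * emb U b) ∈ sp g X)
    (hbd : ∀ g ∈ W, ∀ (X : C.Dom), ∀ V ∈ sp g X, ‖Ecx g X V‖ ≤ E₀ * Real.exp (-(κ * C.d X)))
    (hreal : ∀ g ∈ W, ∀ (X : C.Dom) (U : C.BgA), Ecx g X (emb U) = (EA g U X : ℂ)) :
    DecayBound EA W E₀ κ := by
  intro g hg U X
  have hsz0 : sz U 0 ≤ 0 := by
    have h := hsz U 0 0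
    rwa [smul_zero, norm_zero, zero_mul] at h
  have hmem : (fun b => exp ((0 : ι → 𝔸) b) * emb U b) ∈ sp g X :=
    htube g hg X U 0 (hsz0.trans_lt (hϱ g hg _))
  have e : (fun b => exp ((0 : ι → 𝔸) b) * emb U b) = emb U := by
    funext b; rw [Pi.zero_apply, exp_zero, one_mul]
  have h := hbd g hg X _ hmem
  rwa [e, hreal g hg X U, Complex.norm_real, Real.norm_eq_abs] at h

end PairLine

/-! ## §2 The bracket (T) from the tube binders: generic radius, the printed radius, and at the spine carriers -/

section Bracket

variable {ι : Type*} [Fintype ι] {𝔸 : Type*} [CStarAlgebra 𝔸] {C : Carriers}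

/-- **`LipBackground` FROM THE TUBE, generic positive radius family**: the six tube binders of `pairDisc_of_tubeLine` give
`LipBackground EA W κ (2E₀∕ϱ)` — `N19LipBracketTube.lipBackground_of_pairDisc` with BOTH its Bałaban-side inputs (`hdecay`,
`hdisc`) supplied from print's shape in tree letters. [folklore] -/
theorem lipBackground_of_tubeLine {EA : Functional C C.BgA} {W : Set (ℕ → ℝ)} {κ E₀ : ℝ} {ϱ : (ℕ → ℝ) → ℕ → ℝ}
    (emb : C.BgA → ι → 𝔸) (sz : C.BgA → (ι → 𝔸) → ℝ) (sp : (ℕ → ℝ) → C.Dom → Set (ι → 𝔸))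
    (Ecx : (ℕ → ℝ) → C.Dom → (ι → 𝔸) → ℂ) (hϱ : ∀ g ∈ W, ∀ j, 0 < ϱ g j)
    (hsz : ∀ (U : C.BgA) (K : ι → 𝔸) (c : ℂ), sz U (c • K) ≤ ‖c‖ * sz U K)
    (htube : ∀ g ∈ W, ∀ (X : C.Dom) (U : C.BgA) (K : ι → 𝔸), sz U K < ϱ g (C.scale X) →
      (fun b => exp (K b) * emb U b) ∈ sp g X)
    (hhol : ∀ g ∈ W, ∀ X : C.Dom, DifferentiableOn ℂ (Ecx g X) (sp g X))
    (hbd : ∀ g ∈ W, ∀ (X : C.Dom), ∀ V ∈ sp g X, ‖Ecx g X V‖ ≤ E₀ * Real.exp (-(κ * C.d X)))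
    (hreal : ∀ g ∈ W, ∀ (X : C.Dom) (U : C.BgA), Ecx g X (emb U) = (EA g U X : ℂ))
    (hreach : ∀ g ∈ W, ∀ (X : C.Dom) (U U' : C.BgA), C.gauge U U' < ϱ g (C.scale X) →
      ∃ K : ι → 𝔸, sz U K ≤ C.gauge U U' ∧ emb U' = fun b => exp (K b) * emb U b) :
    LipBackground EA W κ (fun g j => 2 * E₀ / ϱ g j) :=
  lipBackground_of_pairDisc hϱ (decayBound_of_tubeLine emb sz sp Ecx hϱ hsz htube hbd hreal)
    (pairDisc_of_tubeLine emb sz sp Ecx hsz htube hhol hbd hreal hreach)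

/-- **THE BRACKET (T) OVER ABSTRACT CARRIERS FROM THE TUBE AT THE PRINTED RADIUS `κ₁·α(C₁, q₁, g_j)`** ((2.28)·(2.39)):
`∃ CU Pg, LipBackground EA W κ CU ∧ PolyLipGrowth CU gA Pg 1 ∧ 0 ≤ Pg` — `N19LipBracketTube.lipBracket_of_pairDisc` with
`hdecay` DERIVED and `hdisc` REPLACED by the tube binders; the letters (signs, window smallness, tables with the upper
running (2.6)∕(0.31)) unchanged. [folklore] -/
theorem lipBracket_of_tubeLine {EA : Functional C C.BgA} {W : Set (ℕ → ℝ)} {κ E₀ κ₁ C₁ β' gIR : ℝ} {q₁ : ℕ}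
    {gA : ℕ → ℕ → ℝ} (emb : C.BgA → ι → 𝔸) (sz : C.BgA → (ι → 𝔸) → ℝ) (sp : (ℕ → ℝ) → C.Dom → Set (ι → 𝔸))
    (Ecx : (ℕ → ℝ) → C.Dom → (ι → 𝔸) → ℂ)
    -- the size functional is absolutely homogeneous
    (hsz : ∀ (U : C.BgA) (K : ι → 𝔸) (c : ℂ), sz U (c • K) ≤ ‖c‖ * sz U K)
    -- (1.13)∕(2.39): the tube of half-width κ₁·α_{1,j} about every run-A background lies in the space
    (htube : ∀ g ∈ W, ∀ (X : C.Dom) (U : C.BgA) (K : ι → 𝔸),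
      sz U K < κ₁ * B14.alphaJ C₁ q₁ (g (C.scale X)) → (fun b => exp (K b) * emb U b) ∈ sp g X)
    -- (2.27)(ii)+(iv) on the space, and real agreement
    (hhol : ∀ g ∈ W, ∀ X : C.Dom, DifferentiableOn ℂ (Ecx g X) (sp g X))
    (hbd : ∀ g ∈ W, ∀ (X : C.Dom), ∀ V ∈ sp g X, ‖Ecx g X V‖ ≤ E₀ * Real.exp (-(κ * C.d X)))
    (hreal : ∀ g ∈ W, ∀ (X : C.Dom) (U : C.BgA), Ecx g X (emb U) = (EA g U X : ℂ))
    -- chart convention: the gauge is the size of the connecting generator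
    (hreach : ∀ g ∈ W, ∀ (X : C.Dom) (U U' : C.BgA), C.gauge U U' < κ₁ * B14.alphaJ C₁ q₁ (g (C.scale X)) →
      ∃ K : ι → 𝔸, sz U K ≤ C.gauge U U' ∧ emb U' = fun b => exp (K b) * emb U b)
    -- LETTERS: signs and the window's smallness
    (hE₀ : 0 ≤ E₀) (hκ₁ : 0 < κ₁) (hC₁ : 0 < C₁) (hW : ∀ g ∈ W, ∀ j, 0 < g j ∧ g j ^ 2 ≤ Real.exp (-1))
    -- run A's cutoff tables and the upper running of the couplings ((2.6) ∕ (0.31))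
    (hgA : ∀ K, gA K ∈ W) (hup : ∀ K j, j ≤ K → 1 / gA K j ^ 2 ≤ 1 / gIR ^ 2 + β' * ((K : ℝ) - j))
    (hgIR : 0 < gIR) (hβ' : 0 ≤ β') :
    ∃ (CU : (ℕ → ℝ) → ℕ → ℝ) (Pg : ℝ), LipBackground EA W κ CU ∧ PolyLipGrowth CU gA Pg 1 ∧ 0 ≤ Pg :=
  have hϱ : ∀ g ∈ W, ∀ j, 0 < κ₁ * B14.alphaJ C₁ q₁ (g j) :=
    fun g hg j => radius_pos q₁ hκ₁ hC₁ (hW g hg j).1 (hW g hg j).2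
  lipBracket_of_pairDisc
    (decayBound_of_tubeLine (ϱ := fun g j => κ₁ * B14.alphaJ C₁ q₁ (g j)) emb sz sp Ecx hϱ hsz htube hbd hreal)
    (pairDisc_of_tubeLine (ϱ := fun g j => κ₁ * B14.alphaJ C₁ q₁ (g j)) emb sz sp Ecx hsz htube hhol hbd hreal hreach)
    hE₀ hκ₁ hC₁ hW hgA hup hgIR hβ'

open YMDAG.UVSplit (U3Carriers RateCarriers)

/-- **THE HYPOTHESIS-ONLY BRACKET AT NODE U3's CARRIERS, TUBE-LINE READING.**  For the U3 sub-bundle `u` of the K4 rate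
carriers and run A's cutoff tables `g` of the N19′ link reading: from a chart `emb` of `u`'s run-A backgrounds into bond
configurations `ι → 𝔸` (C⋆-algebra, intended `SU(2) ⊂ M₂(ℂ)` on the bonds of the torus), a homogeneous size `sz`, spaces
`sp s X` containing the (1.13) tubes of half-width `κ₁·α(C₁, q₁, s_j)` about the run-A backgrounds, an extension `Ecx s X`
of `u.EA s · X` HOLOMORPHIC on `sp s X` with the (1.18) bound there ((2.27)(ii)(iv) AS PRINTED, in the tree's [B10] tube
letters) and the reach convention; plus the signs, the window's smallness and the tables' membership + upper running:
**`∃ CU Pg, LipBackground u.EA u.W u.κ CU ∧ PolyLipGrowth CU g Pg 1 ∧ 0 ≤ Pg`** — LITERALLY the component (T) of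
`N19RateEdgeByName.rateEdge_of_linkReading_byName` (`q := 1`).  CONDITIONAL on every binder; nothing of Bałaban's
instantiated; NOT NE7; N19 NOT discharged. [folklore] -/
theorem lipBracket_at_u3Carriers_of_tubeLine (u : U3Carriers) {E₀ κ₁ C₁ β' gIR : ℝ} {q₁ : ℕ} {g : ℕ → ℕ → ℝ}
    (emb : u.C.BgA → ι → 𝔸) (sz : u.C.BgA → (ι → 𝔸) → ℝ) (sp : (ℕ → ℝ) → u.C.Dom → Set (ι → 𝔸))
    (Ecx : (ℕ → ℝ) → u.C.Dom → (ι → 𝔸) → ℂ)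
    (hsz : ∀ (U : u.C.BgA) (K : ι → 𝔸) (c : ℂ), sz U (c • K) ≤ ‖c‖ * sz U K)
    (htube : ∀ s ∈ u.W, ∀ (X : u.C.Dom) (U : u.C.BgA) (K : ι → 𝔸),
      sz U K < κ₁ * B14.alphaJ C₁ q₁ (s (u.C.scale X)) → (fun b => exp (K b) * emb U b) ∈ sp s X)
    (hhol : ∀ s ∈ u.W, ∀ X : u.C.Dom, DifferentiableOn ℂ (Ecx s X) (sp s X))
    (hbd : ∀ s ∈ u.W, ∀ (X : u.C.Dom), ∀ V ∈ sp s X, ‖Ecx s X V‖ ≤ E₀ * Real.exp (-(u.κ * u.C.d X)))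
    (hreal : ∀ s ∈ u.W, ∀ (X : u.C.Dom) (U : u.C.BgA), Ecx s X (emb U) = (u.EA s U X : ℂ))
    (hreach : ∀ s ∈ u.W, ∀ (X : u.C.Dom) (U U' : u.C.BgA),
      u.C.gauge U U' < κ₁ * B14.alphaJ C₁ q₁ (s (u.C.scale X)) →
      ∃ K : ι → 𝔸, sz U K ≤ u.C.gauge U U' ∧ emb U' = fun b => exp (K b) * emb U b)
    (hE₀ : 0 ≤ E₀) (hκ₁ : 0 < κ₁) (hC₁ : 0 < C₁) (hW : ∀ s ∈ u.W, ∀ j, 0 < s j ∧ s j ^ 2 ≤ Real.exp (-1))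
    (hgA : ∀ K, g K ∈ u.W) (hup : ∀ K j, j ≤ K → 1 / g K j ^ 2 ≤ 1 / gIR ^ 2 + β' * ((K : ℝ) - j))
    (hgIR : 0 < gIR) (hβ' : 0 ≤ β') :
    ∃ (CU : (ℕ → ℝ) → ℕ → ℝ) (Pg : ℝ), LipBackground u.EA u.W u.κ CU ∧ PolyLipGrowth CU g Pg 1 ∧ 0 ≤ Pg :=
  lipBracket_of_tubeLine emb sz sp Ecx hsz htube hhol hbd hreal hreach hE₀ hκ₁ hC₁ hW hgA hup hgIR hβ'

/-- The same at the RATE-CARRIER BUNDLE `R : RateCarriers N` of the K4 split, read at its U3 sub-bundle `R.u3` — the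
letters of `N19RateEdgeByName.rateEdge_of_linkReading_byName`'s clause verbatim (`R.u3.EA`, `R.u3.W`, `R.u3.κ`).
[folklore] -/
theorem lipBracket_at_rateCarriers_of_tubeLine {N : ℕ} (R : RateCarriers N) {E₀ κ₁ C₁ β' gIR : ℝ} {q₁ : ℕ}
    {g : ℕ → ℕ → ℝ} (emb : R.u3.C.BgA → ι → 𝔸) (sz : R.u3.C.BgA → (ι → 𝔸) → ℝ)
    (sp : (ℕ → ℝ) → R.u3.C.Dom → Set (ι → 𝔸)) (Ecx : (ℕ → ℝ) → R.u3.C.Dom → (ι → 𝔸) → ℂ)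
    (hsz : ∀ (U : R.u3.C.BgA) (K : ι → 𝔸) (c : ℂ), sz U (c • K) ≤ ‖c‖ * sz U K)
    (htube : ∀ s ∈ R.u3.W, ∀ (X : R.u3.C.Dom) (U : R.u3.C.BgA) (K : ι → 𝔸),
      sz U K < κ₁ * B14.alphaJ C₁ q₁ (s (R.u3.C.scale X)) → (fun b => exp (K b) * emb U b) ∈ sp s X)
    (hhol : ∀ s ∈ R.u3.W, ∀ X : R.u3.C.Dom, DifferentiableOn ℂ (Ecx s X) (sp s X))
    (hbd : ∀ s ∈ R.u3.W, ∀ (X : R.u3.C.Dom), ∀ V ∈ sp s X,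
      ‖Ecx s X V‖ ≤ E₀ * Real.exp (-(R.u3.κ * R.u3.C.d X)))
    (hreal : ∀ s ∈ R.u3.W, ∀ (X : R.u3.C.Dom) (U : R.u3.C.BgA), Ecx s X (emb U) = (R.u3.EA s U X : ℂ))
    (hreach : ∀ s ∈ R.u3.W, ∀ (X : R.u3.C.Dom) (U U' : R.u3.C.BgA),
      R.u3.C.gauge U U' < κ₁ * B14.alphaJ C₁ q₁ (s (R.u3.C.scale X)) →
      ∃ K : ι → 𝔸, sz U K ≤ R.u3.C.gauge U U' ∧ emb U' = fun b => exp (K b) * emb U b)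
    (hE₀ : 0 ≤ E₀) (hκ₁ : 0 < κ₁) (hC₁ : 0 < C₁) (hW : ∀ s ∈ R.u3.W, ∀ j, 0 < s j ∧ s j ^ 2 ≤ Real.exp (-1))
    (hgA : ∀ K, g K ∈ R.u3.W) (hup : ∀ K j, j ≤ K → 1 / g K j ^ 2 ≤ 1 / gIR ^ 2 + β' * ((K : ℝ) - j))
    (hgIR : 0 < gIR) (hβ' : 0 ≤ β') :
    ∃ (CU : (ℕ → ℝ) → ℕ → ℝ) (Pg : ℝ),
      LipBackground R.u3.EA R.u3.W R.u3.κ CU ∧ PolyLipGrowth CU g Pg 1 ∧ 0 ≤ Pg :=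
  lipBracket_at_u3Carriers_of_tubeLine R.u3 emb sz sp Ecx hsz htube hhol hbd hreal hreach hE₀ hκ₁ hC₁ hW hgA hup
    hgIR hβ'

end Bracket

end Summit.QuantumFields.YangMills.BalabanUVNodes.N19LipBracketTubeLine
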